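import Literature.AlgebraicGeometry.Motives.CubeStepIPoint
import Literature.AlgebraicGeometry.Motives.CubeSeesawKrull
import HarnessLib

/-!
# The theorem of the cube over a NON-reduced base: faces + fibres + seesaw ⟹ the bundle comes from the base

Layer `Literature/AlgebraicGeometry/Motives`, namespace `Literature.AlgebraicGeometry.Motives`.  THEOREMS ONLY (no definition, no named
fact, no instance, no notation).  Cell `hodgecm-mathlib` (D-0151), F-2d road (R-def) «theorem of the cube over a NON-reduced base», brick
D5c-γ0 (author B-p07 (g16)) = the assembly of ★ `nonempty_unit_iso_infinitesimal` (GW II Lemma 24.72 Step (I) at every point of the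
base, ★ `Motives/CubeStepIPoint`) with ★ `exists_iso_pullback_snd_of_seesaw_of_infinitesimal` (seesaw + Krull, ★ `Motives/CubeSeesawKrull`):

* §1 `surjective_toSectionsBase_of_univStein` — the Stein hypothesis of ★ `cubeStepI_localRing` ∕ ★ `nonempty_unit_iso_infinitesimal`
  («`A/𝔪^{n+1} → Γ(X_A ⊗ A/𝔪^{n+1}, 𝒪)` surjective», `A = 𝒪_{W,t}`) from UNIVERSAL STEINNESS of `X → Spec R` («`Γ(V, 𝒪_T) → Γ(X ×_R V, 𝒪)`
  bijective for every `T/R`», ★ `SeesawRelative.UnivStein`, [GortzWedhorn2023] Cor. 24.63), through Mathlib's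
  `pullbackLeftPullbackSndIso : (X ×_R Spec A) ×_A Spec B ≅ X ×_R Spec B`.
* §2 **`exists_iso_pullback_snd_of_faces_of_fibres`** — [MumfordAV1970] §6 Theorem of the cube ∕ §10 Seesaw, [GortzWedhorn2023]
  Lemma 24.72 over a base: for `X, Y → Spec R` flat, proper, with geometrically integral fibres, universally Stein, with sections
  `x, y` (affine as morphisms), `W → Spec R` locally noetherian, and a rank-one `N` on `(X ⊗ Y) ⊗ W` trivial on `({x} × Y) ⊗ W`, on
  `(X × {y}) ⊗ W` and on every fibre `(X ⊗ Y) × {t}` (`t ∈ W`), GIVEN the seesaw closed subscheme `i : Z ↪ W` of `N` (universal for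
  «`N|_{(X ⊗ Y) ×_W S} ≅ pr_S^*𝓜`», ★ `SeesawRelative.exists_seesawSubscheme…`): `N ≅ pr_W^*𝓜` for a rank-one quasi-coherent `𝓜` on
  `W`.  (Step (I) makes every `Spec(𝒪_{W,t}/𝔪^{n+1}) → W` factor through `Z`; Krull ★ `IsClosedImmersion.isIso_of_forall_infinitesimal_factors`
  forces `Z = W`.)

HC_CM is proved only modulo the 7 printed citations until rung 0 closes; nothing here is about HC.

## References
* [MumfordAV1970] D. Mumford, *Abelian Varieties* (1970), §6 (theorem of the cube, proof), §10 (seesaw, p. 89).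
* [GortzWedhorn2023] U. Görtz, T. Wedhorn, *Algebraic Geometry II* (2023), Lemma 24.72 (p. 409), Cor. 24.63 (p. 404).
-/

noncomputable section

universe u

open CategoryTheory CategoryTheory.Limits AlgebraicGeometry MonoidalCategory CartesianMonoidalCategory TensorProduct
open IsLocalRing
open Literature.AlgebraicGeometry.Morphisms Literature.AlgebraicGeometry.Morphisms.CechUnitCocycle
open Literature.AlgebraicGeometry.Modules
open Literature.AlgebraicGeometry.AbelianSchemes.AbelianSchemeOver

namespace Literature.AlgebraicGeometry.Motives

variable {R : Type u} [CommRing R]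

/-! ## §1 Stein over the Artinian quotients of a local ring of the base, from universal Steinness -/

/-- **Universal Steinness of `X → Spec R` gives the Stein hypothesis of Step (I)**: for every `ρ : Spec A → Spec R` and every
`A`-algebra `B`, `B → Γ((X ×_R Spec A) ×_A Spec B, 𝒪)` (★ `toSectionsBase`) is surjective. [cite: GortzWedhorn2023, Cor. 24.63 (p. 404)] -/
theorem surjective_toSectionsBase_of_univStein (X : SchemeOver R)
    (hSt : ∀ (T : SchemeOver R) (V : T.left.Opens), Function.Bijective ((CartesianMonoidalCategory.snd X T).left.app V))
    {A : Type u} [CommRing A] (ρ : Spec (.of A) ⟶ Spec (.of R)) (B : Type u) [CommRing B] [Algebra A B] :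
    Function.Surjective (toSectionsBase A
      (pullback.snd ((Over.pullback ρ).obj X).hom (Spec.map (CommRingCat.ofHom (algebraMap A B)))) ⊤) := by
  intro s
  let σ : Spec (.of B) ⟶ Spec (.of A) := Spec.map (CommRingCat.ofHom (algebraMap A B))
  let e := pullbackLeftPullbackSndIso X.hom ρ σ
  have he : pullback.snd ((Over.pullback ρ).obj X).hom σ = e.hom ≫ pullback.snd X.hom (σ ≫ ρ) :=
    (pullbackLeftPullbackSndIso_hom_snd X.hom ρ σ).symm
  -- `e.hom^♯` is bijective, `pr₂^♯` is bijective (universal Steinness at `T = Spec B → Spec R`)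
  obtain ⟨y, hy⟩ := (ConcreteCategory.bijective_of_isIso (e.hom.app ⊤)).2 s
  obtain ⟨x, hx⟩ := (hSt (Over.mk (σ ≫ ρ)) ⊤).2 y
  refine ⟨(Scheme.ΓSpecIso (.of B)).hom x, ?_⟩
  have happ : (pullback.snd ((Over.pullback ρ).obj X).hom σ).appLE ⊤ ⊤ le_top =
      (pullback.snd ((Over.pullback ρ).obj X).hom σ).appTop :=
    ((pullback.snd ((Over.pullback ρ).obj X).hom σ).app_eq_appLE (U := ⊤)).symm
  change (pullback.snd ((Over.pullback ρ).obj X).hom σ).appLE ⊤ ⊤ le_top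
    ((Scheme.ΓSpecIso (.of B)).inv ((Scheme.ΓSpecIso (.of B)).hom x)) = s
  rw [Iso.hom_inv_id_apply, happ, he, Scheme.Hom.comp_appTop]
  exact (congrArg (fun z => e.hom.app ⊤ z) hx).trans hy

/-- The Stein hypothesis of ★ `nonempty_unit_iso_infinitesimal` at a point `t` of an `R`-scheme `W`, from universal Steinness of
`X → Spec R` (§1 at `A = 𝒪_{W,t}`, `B = 𝒪_{W,t}/𝔪^{n+1}`). [cite: GortzWedhorn2023, Cor. 24.63 (p. 404)] -/
theorem surjective_toSectionsBase_stalk_of_univStein (X W : SchemeOver R)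
    (hSt : ∀ (T : SchemeOver R) (V : T.left.Opens), Function.Bijective ((CartesianMonoidalCategory.snd X T).left.app V))
    (t : W.left) (n : ℕ) :
    Function.Surjective (toSectionsBase (W.left.presheaf.stalk t)
      (pullback.snd ((Over.pullback (W.left.fromSpecStalk t ≫ W.hom)).obj X).hom
        (Spec.map (CommRingCat.ofHom (algebraMap (W.left.presheaf.stalk t)
          (↑(W.left.presheaf.stalk t) ⧸ maximalIdeal (W.left.presheaf.stalk t) ^ (n + 1)))))) ⊤) :=
  -- `A`, `B` and their instances are read off the statement (unification), not off `ρ`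
  surjective_toSectionsBase_of_univStein X hSt _ _

/-! ## §2 The cube over a base: faces + fibres + seesaw -/

/-- **THE THEOREM OF THE CUBE OVER A (POSSIBLY NON-REDUCED) LOCALLY NOETHERIAN BASE, relative form** ([MumfordAV1970] §6 with §10;
[GortzWedhorn2023] Lemma 24.72): see the module docstring.  The seesaw closed subscheme `i : Z ↪ W` of `N` is a hypothesis
(`huniv`, the conclusion of ★ `SeesawRelative.exists_seesawSubscheme…`); the fibre hypothesis is at every point `t ∈ W` (residue field
`κ(t)`). [cite: MumfordAV1970, §6 (theorem of the cube, proof) and §10 (p. 89)] [cite: GortzWedhorn2023, Lemma 24.72 (p. 409)] -/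
theorem exists_iso_pullback_snd_of_faces_of_fibres (X Y W : SchemeOver R) [Flat X.hom] [Flat Y.hom] [IsProper X.hom]
    [IsProper Y.hom] [GeometricallyIntegral X.hom] [GeometricallyIntegral Y.hom] [IsLocallyNoetherian W.left]
    (hStX : ∀ (T : SchemeOver R) (V : T.left.Opens), Function.Bijective ((CartesianMonoidalCategory.snd X T).left.app V))
    (hStY : ∀ (T : SchemeOver R) (V : T.left.Opens), Function.Bijective ((CartesianMonoidalCategory.snd Y T).left.app V))
    (x : 𝟙_ (SchemeOver R) ⟶ X) (y : 𝟙_ (SchemeOver R) ⟶ Y) [IsAffineHom x.left] [IsAffineHom y.left]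
    (N : ((X ⊗ Y) ⊗ W).left.Modules) (hN : HasRank N 1) {Z : SchemeOver R} (i : Z ⟶ W) [IsClosedImmersion i.left]
    (huniv : ∀ (S : SchemeOver R) (u : S ⟶ W), (∃ v : S ⟶ Z, v ≫ i = u) ↔
      ∃ (𝓜 : S.left.Modules) (_ : 𝓜.IsQuasicoherent) (_ : HasRank 𝓜 1),
        Nonempty ((Scheme.Modules.pullback ((X ⊗ Y) ◁ u).left).obj N ≅ (Scheme.Modules.pullback (snd (X ⊗ Y) S).left).obj 𝓜))
    (h₁ : Nonempty (unitModule _ ≅ (Scheme.Modules.pullback (((λ_ Y).inv ≫ x ▷ Y) ▷ W).left).obj N))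
    (h₂ : Nonempty (unitModule _ ≅ (Scheme.Modules.pullback (((ρ_ X).inv ≫ X ◁ y) ▷ W).left).obj N))
    (hfib : ∀ t : W.left, Nonempty (unitModule _ ≅ (Scheme.Modules.pullback ((X ⊗ Y) ◁
      (Over.homMk (W.left.fromSpecResidueField t) rfl : Over.mk (W.left.fromSpecResidueField t ≫ W.hom) ⟶ W)).left).obj N)) :
    ∃ (𝓜 : W.left.Modules) (_ : 𝓜.IsQuasicoherent) (_ : HasRank 𝓜 1),
      Nonempty (N ≅ (Scheme.Modules.pullback (snd (X ⊗ Y) W).left).obj 𝓜) :=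
  exists_iso_pullback_snd_of_seesaw_of_infinitesimal (X ⊗ Y) W N i huniv fun t n g hg =>
    nonempty_unit_iso_infinitesimal X Y W x y t
      (surjective_toSectionsBase_stalk_of_univStein X W hStX t) (surjective_toSectionsBase_stalk_of_univStein Y W hStY t)
      N hN h₁ h₂ (hfib t) n g hg

end Literature.AlgebraicGeometry.Motives

end
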